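import Mathlib
import Literature.Analysis.FluidPDE.StrainedAzimuthalFlow
import HarnessLib

/-!
# A Gaussian vortex tube of arbitrary width in the axisymmetric strain: the linearised axial
# vorticity balance, the axis rate `γ(1 − δ_B²/δ²)`, and «the only Gaussian eigen-tube is Burgers,
# and it is neutral»

HONEST FRAMING (cell `ns-blowup`, seat `ns-blowup-instab`, human ruling D-0035): nothing here is
a claim about Navier–Stokes blow-up. WHAT THIS IS NOT: not a statement about the marginal tower
N1* nor about the ABC eigenproblem; it is the EXACT local computation behind reading (i) of the
cell's CLAIM A6 (RATE-AUDIT §6.6.4(c): "a steady co-signed pinned rope has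
`γ = σ₁(1 − (δ_B/δ)²) − ν/ℓ₁²` … FATTER than Burgers"), in the local model of an ABC `α`-point:
the axisymmetric straining flow `U(x) = (−γx₀/2, −γx₁/2, γx₂)` (tree: `axisymmetricStrain γ`,
`SteadyStrainedNS.lean`; the ABC 1:1:1 `α`-points have exactly this strain with `γ = σ_α = √2`).

For the axial vorticity `ω(x) = G(x) e₂`, `G(x) = exp(−a ρ(x))`, `ρ = x₀² + x₁²` (a Gaussian tube
of width `δ = a^{−1/2}` along the stretching axis), the linearised vorticity equation about `U`
(`∂ₜω = (ω·∇)U − (U·∇)ω + νΔω`; the host is irrotational, so no `Ω̄`-terms) acts on the axial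
component by `L G := γ G − DG·U + νΔG`. We prove (all pointwise, exact):

* `linearised_gauss` — `L G = (γ − 4νa + ρ(4νa² − γa)) G`
  (tree calculus: `StrainedAzimuthal.laplacian_comp_rho`, `fderiv_comp_rho_apply`);
* `linearised_gauss_axis` — on the axis (`ρ = 0`) the local rate is `γ − 4νa`, i.e.
  `γ(1 − δ_B²/δ²)` with `δ_B² = 4ν/γ` the Burgers width (`axisRate_eq`): positive iff the tube is
  FATTER than Burgers (`axisRate_pos_iff`) — A6 reading (i) at `ℓ₁ = ∞`;
* `eigen_iff` — `L G = μ G` holds at every point iff `μ = γ − 4νa` and `a(4νa − γ) = 0`; so for a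
  genuine tube (`a ≠ 0`) iff it is the Burgers tube `4νa = γ` AND `μ = 0` (`eigen_iff_burgers`):
  **in the local straining model no Gaussian tube is a growing steady eigenmode; the only eigen-tube
  is Burgers and it is neutral.** A fatter tube has a positive axis rate but a negative `ρ`-slope
  (`4νa² − γa < 0`): it is relaxing toward Burgers, not growing as a mode.

Reading for the cell (HEUR, not proved here): a steady separatrix-pinned co-signed branch of the
ABC eigenproblem with `γ_II > 0` (P-LADDER-3 EARLY SIGNAL, `γ_II/σ_α ≈ 0.1` at `R = 100`) is
therefore NOT fed by the local Burgers balance at the `α`-point; its growth is a non-local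
(finite-cell, recirculating) effect, and its `R → ∞` trend is that of the network transfer.
References: J. M. Burgers, Adv. Appl. Mech. 1 (1948) 171; Th. Gallay, C. E. Wayne, Comm. Math.
Phys. 255 (2005) 97 (spectrum `{−n/2}` of the 2-D analogue in Gaussian-weighted `L²`, top
eigenvalue `0` with the Gaussian); cell files `instab/RATE-AUDIT.md` §6.6.4(c), KILLSHEET §XIII.
-/

noncomputable section

open Real InnerProductSpace
open scoped Laplacian

namespace Summit.NavierStokesRegularity.FluidComputer.StrainedGaussianTube

open Literature.Analysis.FluidPDE Literature.Analysis.FluidPDE.StrainedAzimuthal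

/-! ### Calculus of the Gaussian profile `g(s) = exp(−a s)` -/

/-- `g'(s) = −a e^{−as}`. -/
theorem hasDerivAt_gauss (a t : ℝ) :
    HasDerivAt (fun s => exp (-(a * s))) (-(a * exp (-(a * t)))) t := by
  have h : HasDerivAt (fun s : ℝ => -(a * s)) (-a) t := by
    simpa using (hasDerivAt_id t).const_mul (-a)
  convert h.exp using 1
  ring

/-- `g''(s) = a² e^{−as}`. -/
theorem hasDerivAt_gauss' (a t : ℝ) :
    HasDerivAt (fun s => -(a * exp (-(a * s)))) (a ^ 2 * exp (-(a * t))) t := by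
  have h := (hasDerivAt_gauss a t).const_mul (-a)
  have e1 : (fun s => -a * exp (-(a * s))) = fun s => -(a * exp (-(a * s))) := by
    funext s; ring
  rw [e1] at h
  exact h.congr_deriv (by ring)

/-- `g` is `C²` (indeed smooth). -/
theorem contDiff_gauss (a : ℝ) : ContDiff ℝ 2 (fun s : ℝ => exp (-(a * s))) :=
  (contDiff_exp.comp (contDiff_const.mul contDiff_id).neg)

/-- **Laplacian of the tube**: `Δ e^{−aρ} = (4ρa² − 4a) e^{−aρ}` (two transverse directions). -/
theorem laplacian_gauss (a : ℝ) (x : EuclideanSpace ℝ (Fin 3)) :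
    (Δ (fun y : EuclideanSpace ℝ (Fin 3) => exp (-(a * rho y)))) x =
      (4 * rho x * a ^ 2 - 4 * a) * exp (-(a * rho x)) := by
  rw [laplacian_comp_rho (contDiff_gauss a) (hasDerivAt_gauss a) (hasDerivAt_gauss' a) x]
  ring

/-- **Transport by the strain**: `DG(x)·U(x) = γ a ρ e^{−aρ}` (the converging transverse flow
`(−γx₀/2, −γx₁/2)` pushes the profile inward: `−(U·∇)G = −γaρG`). -/
theorem fderiv_gauss_strain (γ a : ℝ) (x : EuclideanSpace ℝ (Fin 3)) :
    fderiv ℝ (fun y : EuclideanSpace ℝ (Fin 3) => exp (-(a * rho y))) x (axisymmetricStrain γ x) =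
      γ * a * rho x * exp (-(a * rho x)) := by
  rw [fderiv_comp_rho_apply (hasDerivAt_gauss a)]
  simp only [axisymmetricStrain, linearStrain_apply_zero, linearStrain_apply_one, rho_apply]
  ring

/-! ### The linearised axial vorticity balance -/

/-- **The linearised axial-vorticity operator on a Gaussian tube.** With `U = axisymmetricStrain γ`
and `G = e^{−aρ}`:
`γ G − DG·U + νΔG = (γ − 4νa + ρ(4νa² − γa)) G` at every point. -/
theorem linearised_gauss (γ ν a : ℝ) (x : EuclideanSpace ℝ (Fin 3)) :
    γ * exp (-(a * rho x)) -
        fderiv ℝ (fun y : EuclideanSpace ℝ (Fin 3) => exp (-(a * rho y))) x (axisymmetricStrain γ x) +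
        ν * (Δ (fun y : EuclideanSpace ℝ (Fin 3) => exp (-(a * rho y)))) x =
      (γ - 4 * ν * a + rho x * (4 * ν * a ^ 2 - γ * a)) * exp (-(a * rho x)) := by
  rw [fderiv_gauss_strain, laplacian_gauss]
  ring

/-- **On the axis** (`ρ(x) = 0`, e.g. `x = x_α`): the local rate is `γ − 4νa`. -/
theorem linearised_gauss_axis (γ ν a : ℝ) {x : EuclideanSpace ℝ (Fin 3)} (hx : rho x = 0) :
    γ * exp (-(a * rho x)) -
        fderiv ℝ (fun y : EuclideanSpace ℝ (Fin 3) => exp (-(a * rho y))) x (axisymmetricStrain γ x) +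
        ν * (Δ (fun y : EuclideanSpace ℝ (Fin 3) => exp (-(a * rho y)))) x =
      (γ - 4 * ν * a) * exp (-(a * rho x)) := by
  rw [linearised_gauss, hx]
  ring

/-- **A6 reading (i), exact local form**: in width language `a = 1/δ²`, `δ_B² = 4ν/γ` (Burgers),
the axis rate is `γ − 4ν/δ² = γ(1 − δ_B²/δ²)`. -/
theorem axisRate_eq {γ ν δ : ℝ} (hγ : γ ≠ 0) (hδ : δ ≠ 0) :
    γ - 4 * ν * (1 / δ ^ 2) = γ * (1 - (4 * ν / γ) / δ ^ 2) := by
  field_simp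

/-- The axis rate is positive iff the tube is FATTER than Burgers: `δ² > δ_B² = 4ν/γ` (`γ > 0`). -/
theorem axisRate_pos_iff {γ ν δ : ℝ} (hγ : 0 < γ) (hδ : 0 < δ) :
    0 < γ - 4 * ν * (1 / δ ^ 2) ↔ 4 * ν / γ < δ ^ 2 := by
  have hδ2 : 0 < δ ^ 2 := by positivity
  rw [sub_pos, show 4 * ν * (1 / δ ^ 2) = 4 * ν / δ ^ 2 by ring, div_lt_iff₀ hδ2,
    div_lt_iff₀ hγ, mul_comm (δ ^ 2) γ]

/-! ### «The only Gaussian eigen-tube is Burgers, and it is neutral» -/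

/-- `ρ` vanishes at the origin. -/
theorem rho_zero : rho (0 : EuclideanSpace ℝ (Fin 3)) = 0 := by
  simp [rho_apply]

/-- `ρ = 1` at the point `e₀`. -/
theorem rho_single_zero : rho (EuclideanSpace.single (0 : Fin 3) (1 : ℝ)) = 1 := by
  simp [rho_apply]

/-- **Eigen-tube criterion.** `L G = μ G` at EVERY point iff `μ = γ − 4νa` and `a(4νa − γ) = 0`
(compare the `ρ⁰` and `ρ¹` coefficients at `x = 0` and `x = e₀`; `G > 0`). -/
theorem eigen_iff (γ ν a μ : ℝ) :
    (∀ x : EuclideanSpace ℝ (Fin 3),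
        γ * exp (-(a * rho x)) -
          fderiv ℝ (fun y : EuclideanSpace ℝ (Fin 3) => exp (-(a * rho y))) x (axisymmetricStrain γ x) +
          ν * (Δ (fun y : EuclideanSpace ℝ (Fin 3) => exp (-(a * rho y)))) x =
        μ * exp (-(a * rho x))) ↔
      (μ = γ - 4 * ν * a ∧ a * (4 * ν * a - γ) = 0) := by
  simp_rw [linearised_gauss]
  constructor
  · intro h
    have h0 := h 0
    have h1 := h (EuclideanSpace.single (0 : Fin 3) (1 : ℝ))
    rw [rho_zero] at h0
    rw [rho_single_zero] at h1
    have e0 : exp (-(a * (0 : ℝ))) ≠ 0 := exp_ne_zero _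
    have e1 : exp (-(a * (1 : ℝ))) ≠ 0 := exp_ne_zero _
    have h0' : γ - 4 * ν * a = μ := by
      have := mul_right_cancel₀ e0 h0
      linarith
    have h1' : γ - 4 * ν * a + (4 * ν * a ^ 2 - γ * a) = μ := by
      have := mul_right_cancel₀ e1 h1
      linarith
    refine ⟨h0'.symm, ?_⟩
    nlinarith [h0', h1']
  · rintro ⟨hμ, ha⟩ x
    have hcoef : 4 * ν * a ^ 2 - γ * a = 0 := by nlinarith [ha]
    rw [hcoef, hμ]
    ring

/-- **Corollary (a genuine tube, `a ≠ 0`): the only Gaussian eigen-tube is the Burgers tube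
`4νa = γ` (`δ = δ_B`), and its eigenvalue is `0`.** No Gaussian tube of any width is a GROWING
steady eigenmode of the local straining problem. -/
theorem eigen_iff_burgers {γ ν a : ℝ} (ha : a ≠ 0) (μ : ℝ) :
    (∀ x : EuclideanSpace ℝ (Fin 3),
        γ * exp (-(a * rho x)) -
          fderiv ℝ (fun y : EuclideanSpace ℝ (Fin 3) => exp (-(a * rho y))) x (axisymmetricStrain γ x) +
          ν * (Δ (fun y : EuclideanSpace ℝ (Fin 3) => exp (-(a * rho y)))) x =
        μ * exp (-(a * rho x))) ↔
      (4 * ν * a = γ ∧ μ = 0) := by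
  rw [eigen_iff]
  constructor
  · rintro ⟨hμ, h⟩
    have h' : 4 * ν * a - γ = 0 := by
      rcases mul_eq_zero.1 h with h0 | h0
      · exact absurd h0 ha
      · exact h0
    refine ⟨by linarith, ?_⟩
    rw [hμ]; linarith
  · rintro ⟨h, hμ⟩
    refine ⟨by rw [hμ]; linarith, ?_⟩
    have : 4 * ν * a - γ = 0 := by linarith
    rw [this, mul_zero]

/-- **The fat tube relaxes**: for `γ > 0`, `ν > 0` and a tube fatter than Burgers (`0 < a`,
`4νa < γ`), the axis rate `γ − 4νa` is positive while the `ρ`-slope `4νa² − γa` is negative — the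
local rate DECREASES away from the axis: the profile is being compressed toward the Burgers width,
not amplified as a mode. -/
theorem fatTube_axis_pos_slope_neg {γ ν a : ℝ} (ha : 0 < a) (hfat : 4 * ν * a < γ) :
    0 < γ - 4 * ν * a ∧ 4 * ν * a ^ 2 - γ * a < 0 := by
  refine ⟨by linarith, ?_⟩
  have : 4 * ν * a ^ 2 - γ * a = a * (4 * ν * a - γ) := by ring
  rw [this]
  exact mul_neg_of_pos_of_neg ha (by linarith)

end Summit.NavierStokesRegularity.FluidComputer.StrainedGaussianTube
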